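import Summits.AtomisticToContinuum.HydrodynamicLimit.Theses.TwoClocks
import Summits.AtomisticToContinuum.HydrodynamicLimit.Theorems.OneFlightGossipEngineEquilibriumClampedCollisionalWindowLDCompositionC3
import Summits.AtomisticToContinuum.HydrodynamicLimit.Theorems.TwoClocksClampedTransferWindowLDFreeKicks
import Summits.AtomisticToContinuum.HydrodynamicLimit.Theorems.TwoClocksClampedTransferWindowLDStubClampDeficitBound
import Summits.AtomisticToContinuum.HydrodynamicLimit.Theorems.TwoClocksClampedTransferWindowLDStubTransferActivityMean
import Summits.AtomisticToContinuum.HydrodynamicLimit.Theorems.OneFlightGossipEngineEnergyCurrentTailsLevelCensusPreCollisionFlux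
import Summits.AtomisticToContinuum.HydrodynamicLimit.Theorems.TwoClocksClampedTransferWindowLDStubStaticTransferActivityTail
import Summits.AtomisticToContinuum.HydrodynamicLimit.Theorems.TwoClocksClampedTransferWindowLDStubIsolatedShellDomination
import Summits.AtomisticToContinuum.HydrodynamicLimit.Theorems.TwoClocksClampedTransferWindowLDStubActivityLocality

/-!
# Line `Sketch` (rung line, v5) — crux `TwoClocks.ClampedTransferWindowLD` = C′ (stmt-AtomisticToContinuum-16623)

Lead-owned skeleton, v5 (continuation lead `prover-line-stmt-AtomisticToContinuum-16623-c1-0`, 2026-08-17; v1–v3 by the gen-1 lead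
`…-16623-0`: v3 = S1–S4 open cores + rungs R1–R5 ALL LANDED — R1 p127928, R2 p128215, R3 p127592, R4+R5 p142345; v4 = v3 + R6–R8
sorried; v5: R6–R8 ALL LANDED by wave 1 — R6 p164064, R7 p165029 (+ helper Legs p164842), R8 p163889 — and imported, so the only
`sorry`s left are again the four open cores S1–S4).

R6–R8 are the provable rungs of the SECOND payload line (crux-ideate r1 ideator 2, card `Ideas/clamp-price-static-shell.md`,
sketch `Cruxes/ClampedTransferWindowLD/IdeatorTwoSketch.lean`), typed over the landed `ClampedTransferCoin` vocabulary:

* **R6 `stub_staticTransferActivityTail`** — the TAGGED, τ-UNIFORM first-moment tail of the window transfer activity: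
  `G_N{act_i > V} ≤ 16 σ³ I(u₀,θ₀) / V` for every particle `i`, every `τ > 0`, `N ≥ 1` (exchangeability of `G_N ∘ Φ` + the landed
  extensive bound `lintegral_overflowCount_le`, R5). The quantitative `V₀` of C′ (card §(6)); the clamp's τ-content is exactly what it
  cannot see.
* **R7 `stub_isolatedShellDomination`** — the card's FIRST LEMMA (pathwise): on a good orbit, the transfer activity of `i` carried by
  ISOLATED binary collisions (inbound leg inside the window, no third sphere within `3ε_N` of either partner during the leg window) is
  at most the window average of the static near-contact SHELL RATE `Σ_{j ≠ i, ε_N < d(x_i,x_j) < 2ε_N} ‖v_i − v_j‖²(1 + ‖v_i + v_j‖/2)`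
  (free inbound leg across the shell `[ε_N, 2ε_N]` of duration `≥ ε_N/‖g‖`; `|Δ‖v_i‖²|/2 = |Δv_i·V_cm|`; legs disjoint; `(σ/τ)/ε_N = w⁻¹`).
  Typed with the lower Lebesgue integral in time (no integrability side-goal). The bridge from the collision-indexed clamp to a
  phase-space observable along the flow.
* **R8 `stub_activityLocality`** — the activity is OWN-PATH-DETERMINED: if the isolated run of `i`'s range-`R` cluster
  (`Literature.Analysis.FluidPDE.localClusterState`) reproduces `i`'s path on `[0, w]`, it reproduces `i`'s window transfer activity
  (first-moment influence locality then transfers the clamp's probability-level price F2 to one infinite-volume system, card §(5)).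

What stays OPEN (not waved; `## Census`): S1–S4 = the four large-deviation cores of the standing composition
(`clampedTransferWindowLD_of_coreLD`, CompositionC3): (F1) N-uniform window LD of clamped collisional currents of deterministic hard
spheres at fixed σ³ over `τσ² → ∞` mean free times (S2–S4), (F2) the tagged transfer-activity LLN inside S1; and the second line's own
dynamical rung `TaggedShellRateCesaroDecay` (Cesàro decay of ONE tagged static autocovariance = tagged-velocity ergodicity of the
infinite equilibrium hard-sphere gas; open in print). The composition `ClampedTransferWindowLD_of` is unchanged and concludes the ROUTE
decl BY NAME from S1–S4.
-/

noncomputable section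

open MeasureTheory ProbabilityTheory Set Filter
open scoped ENNReal BigOperators
open Literature.Analysis.FluidPDE Literature.MathematicalPhysics.KineticTheory
open Literature.Analysis.FunctionSpaces (Torus.partialDeriv Torus.IsSmooth)

namespace Summit.AtomisticToContinuum.HydrodynamicLimit.Theorems.ClampedTransferCoin.SketchLine

/-! ## § 1 The four open large-deviation cores (signatures verbatim from CompositionC1/C3) -/

/-- **S1 · overflow-count LD, pure form** (`OverflowCountLD` of CompositionC3; OPEN — F2 + the collective no-cheap-overflow clause). -/
theorem stub_overflowCountLD :
    ∃ σ₀ : ℝ, 0 < σ₀ ∧ ∀ (a₀ θ₀ : ℝ) (u₀ : V3), 0 < a₀ → 0 < θ₀ → ∀ σ : ℝ, 0 < σ → σ < σ₀ →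
      ∀ Φ : (N : ℕ) → Flow σ N, ∃ V₀ : ℝ, 0 < V₀ ∧ ∀ V : ℝ, V₀ ≤ V → ∃ s₀ : ℝ, 0 < s₀ ∧
        ∀ s : ℝ, 0 ≤ s → s ≤ s₀ → ∀ ε : ℝ, 0 < ε → ∃ τ₀ : ℝ, 0 < τ₀ ∧ ∀ τ : ℝ, τ₀ ≤ τ →
          ∃ N₀ : ℕ, ∀ N : ℕ, N₀ ≤ N →
            ∫⁻ z, ENNReal.ofReal (Real.exp (s * (overflowCount σ τ V (Φ N) z : ℝ))) ∂(gibbs σ a₀ θ₀ u₀ N (Φ N)) ≤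
              ENNReal.ofReal (Real.exp (ε * ((N : ℝ) + 1))) := by
  sorry

/-- **S2 · coin-budget LD** (`CoinBudgetLD` of CompositionC1; OPEN). -/
theorem stub_coinBudgetLD :
    ∃ σ₀ : ℝ, 0 < σ₀ ∧ ∀ (a₀ θ₀ : ℝ) (u₀ : V3), 0 < a₀ → 0 < θ₀ → ∀ σ : ℝ, 0 < σ → σ < σ₀ →
      ∀ Φ : (N : ℕ) → Flow σ N, ∀ L : ℝ, 0 < L → ∃ V₀ : ℝ, 0 < V₀ ∧ ∀ V : ℝ, V₀ ≤ V → ∃ t₀ : ℝ, 0 < t₀ ∧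
        ∀ t : ℝ, 0 ≤ t → t ≤ t₀ → ∀ ε : ℝ, 0 < ε → ∃ τ₀ : ℝ, 0 < τ₀ ∧ ∀ τ : ℝ, τ₀ ≤ τ →
          ∃ N₀ : ℕ, ∀ N : ℕ, N₀ ≤ N → ∀ (H : ℕ) (r : Option (Fin 3)),
            ∫⁻ z, ENNReal.ofReal (Real.exp (∑ n ∈ Finset.range H,
                min (32 * (t * L) ^ 2 * ((window τ N)⁻¹ * coinRange σ τ V (Φ N) r n z) ^ 2)
                  (16 * (t * L) * ((window τ N)⁻¹ * coinRange σ τ V (Φ N) r n z)))) ∂(gibbs σ a₀ θ₀ u₀ N (Φ N)) ≤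
              ENNReal.ofReal (Real.exp (ε * ((N : ℝ) + 1))) := by
  sorry

/-- **S3 · predictable compensator defect LD, pure form** (`CompensatorDefectCoreLD` of CompositionC3; OPEN — the coarse-coin bet). -/
theorem stub_compensatorDefectCoreLD :
    ∃ σ₀ : ℝ, 0 < σ₀ ∧ ∀ (a₀ θ₀ : ℝ) (u₀ : V3), 0 < a₀ → 0 < θ₀ → ∀ σ : ℝ, 0 < σ → σ < σ₀ →
      ∀ Φ : (N : ℕ) → Flow σ N, ∀ φ : T3 → ℝ, Torus.IsSmooth φ → ∃ V₀ : ℝ, 0 < V₀ ∧ ∀ V : ℝ, V₀ ≤ V →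
        ∃ p₀ : ℝ, 0 < p₀ ∧ ∀ p : ℝ, |p| ≤ p₀ → ∀ ε : ℝ, 0 < ε → ∃ τ₀ : ℝ, 0 < τ₀ ∧ ∀ τ : ℝ, τ₀ ≤ τ →
          ∃ N₀ : ℕ, ∀ N : ℕ, N₀ ≤ N →
            ∃ (ℱ : Filtration ℕ (inferInstance : MeasurableSpace (Phase N))) (H : ℕ),
              (∀ (r : Option (Fin 3)) (n : ℕ), StronglyMeasurable[ℱ (n + 1)] (coinMark σ τ V φ (Φ N) r n)) ∧
              (∀ (r : Option (Fin 3)) (n : ℕ), StronglyMeasurable[ℱ n] (coinRange σ τ V (Φ N) r n)) ∧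
              ∀ r : Option (Fin 3),
                ∫⁻ z, ENNReal.ofReal (Real.exp (p * ((window τ N)⁻¹ *
                    (Xa σ τ V φ (Φ N) r z - innov σ a₀ θ₀ u₀ τ V φ (Φ N) ℱ r H z - Kexp σ τ V φ (Φ N) r z))))
                    ∂(gibbs σ a₀ θ₀ u₀ N (Φ N)) ≤
                  ENNReal.ofReal (Real.exp (ε * ((N : ℝ) + 1))) := by
  sorry

/-- **S4 · rate / partner-selection window LD** (`RateWindowLD` of CompositionC1; OPEN — hardest, F1; held by the lead). -/
theorem stub_rateWindowLD :
    ∃ σ₀ : ℝ, 0 < σ₀ ∧ ∀ (a₀ θ₀ : ℝ) (u₀ : V3), 0 < a₀ → 0 < θ₀ → ∀ σ : ℝ, 0 < σ → σ < σ₀ →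
      ∀ Φ : (N : ℕ) → Flow σ N, ∀ φ : T3 → ℝ, Torus.IsSmooth φ → ∃ V₀ : ℝ, 0 < V₀ ∧ ∀ V : ℝ, V₀ ≤ V →
        ∃ p₀ : ℝ, 0 < p₀ ∧ ∀ p : ℝ, |p| ≤ p₀ → ∀ ε : ℝ, 0 < ε → ∃ τ₀ : ℝ, 0 < τ₀ ∧ ∀ τ : ℝ, τ₀ ≤ τ →
          ∃ N₀ : ℕ, ∀ N : ℕ, N₀ ≤ N → ∀ r : Option (Fin 3),
            ∫⁻ z, ENNReal.ofReal (Real.exp (p * ((window τ N)⁻¹ *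
                (Kexp σ τ V φ (Φ N) r z - Arow σ θ₀ u₀ τ φ (Φ N) r z)))) ∂(gibbs σ a₀ θ₀ u₀ N (Φ N)) ≤
              ENNReal.ofReal (Real.exp (ε * ((N : ℝ) + 1))) := by
  sorry

/-! ## § 2 The rungs of the first payload line (ideator 1) — ALL LANDED (R1 p127928, R2 p128215, R3 p127592, R4+R5 p142345) -/

example := @stub_stationaryTruncation
example := @stub_clampDeficitBound
example := @ClampedTransferCoin.stub_freeKickComparison
example := @stub_transferActivityMean
example := @stub_overflowCount_mul_le
example := @lintegral_overflowCount_le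

/-! ## § 2b The rungs of the second payload line (ideator 2, card clamp-price-static-shell) — ALL LANDED (wave 1 of lead c1)

R6 `SketchLine.stub_staticTransferActivityTail` (Theorems/TwoClocksClampedTransferWindowLDStubStaticTransferActivityTail.lean, p164064; with the
reusable exchangeability lemmas `collisionSum_comp_perm`, `runAct_comp_perm`, `gibbs_setOf_lt_runAct_eq`, `lintegral_overflowCount_eq`),
R7 `SketchLine.stub_isolatedShellDomination` (Theorems/TwoClocksClampedTransferWindowLDStubIsolatedShellDomination.lean, p165029; helper file
…StubIsolatedShellDominationLegs.lean, p164842: `isoShell_free`, `isoShell_leg`, `isoShell_impulse_le`, `isoShell_domination` for ANY guard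
implying isolation, `isoShell_sum_le_lintegral`) and R8 `SketchLine.stub_activityLocality`
(Theorems/TwoClocksClampedTransferWindowLDStubActivityLocality.lean, p163889; with `collisionSum_ite_fst_eq_finsum` — first-particle collision
sums are functionals of the own velocity path — and `collisionSum_ite_fst_eq_of_eqOn_Icc`) are imported under their registered names (same
namespace as this skeleton), so they are not re-declared here. Their registered statements were: -/

example := @stub_staticTransferActivityTail
example := @stub_isolatedShellDomination
example := @stub_activityLocality

/- Registered signatures of R6–R8 (kept for the record; the theorems above have exactly these types):

/ - - **R6 · static (τ-uniform) TAGGED transfer-activity tail** (card `StaticTransferActivityTail`, sharpened to the tree's constant):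
under the homogeneous Gibbs law, for EVERY particle `i`, every `τ > 0`, `N ≥ 1`, `V > 0`,
`G_N{V < act_i} ≤ (V (N+1))⁻¹ · 16 σ³ (N+1) · I(u₀, θ₀)` (= `16 σ³ I / V`): exchangeability of `G_N ∘ Φ` under relabelling
(`HardSphereFlow.flow_comp_perm_ae`-type) turns the landed extensive bound `lintegral_overflowCount_le` (R5: `E_G #{i : act_i > V} ≤ …`)
into the tagged one. Markov-level, so it does NOT decay in `τ`. - /
theorem stub_staticTransferActivityTail :
    ∀ {σ : ℝ}, SmallDensity uniformProfile σ → ∀ (a₀ θ₀ : ℝ) (u₀ : V3), 0 < a₀ → 0 < θ₀ → ∀ {N : ℕ}, 1 ≤ N →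
      ∀ (Φ : Flow σ N) (τ : ℝ), 0 < τ → ∀ (V : ℝ), 0 < V → ∀ i : Fin (N + 1),
        (gibbs σ a₀ θ₀ u₀ N Φ) {z | V < runAct σ τ Φ (window τ N) i z} ≤
          (ENNReal.ofReal (V * ((N : ℝ) + 1)))⁻¹ * (ENNReal.ofReal (16 * σ ^ 3 * ((N : ℝ) + 1)) *
            ∫⁻ p, ENNReal.ofReal (‖p.2 - p.1‖ * (‖p.1 - p.2‖ * (1 + ‖p.1 + p.2‖ / 2)))
              ∂((gaussMeasure u₀ θ₀).prod (gaussMeasure u₀ θ₀))) 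

open scoped Classical in
/ - - **R7 · isolated-shell domination** (card `IsolatedShellDomination`, first lemma; pathwise, lintegral-in-time form). On a good orbit of
`N + 1` spheres of diameter `ε_N = hsDiameter σ N < 1/8`, the transfer activity of particle `i` carried by its ISOLATED binary records in
`(0, w]` — records `c` with `c.fst = i`, inbound leg inside the window (`2 ε_N ≤ ‖g‖ · c.time`, `g = v_fst⁻ − v_snd⁻`), and no third
sphere within `3 ε_N` of `i` or of `c.snd` during `[c.time − 2ε_N/‖g‖, c.time]` — is at most `w⁻¹ ∫⁻₀ʷ shellRate_i(Φ_t z) dt`, where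
`shellRate_i(y) = Σ_{j ≠ i, ε_N < ‖sep(x_i,x_j)‖ < 2ε_N} ‖v_i − v_j‖² (1 + ‖v_i + v_j‖/2)`. Per isolated record: the pair flies freely on
the leg window (isolation + "an outgoing pair never re-collides"), the backward flight from contact reaches `≥ √5 ε_N > 2ε_N`, the
passage `2ε_N → ε_N` lasts `≥ ε_N/‖g‖` at constant velocities, and `ε_N (‖Δv_i‖ + |Δ‖v_i‖²|/2) ≤ ε_N ‖g‖ (1 + ‖v_i + v_j‖/2)`; leg
windows of distinct isolated records are disjoint; the other shell terms are `≥ 0`; `(σ/τ) / ε_N = w⁻¹`. (Classical `if`s: state and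
prove it under `open scoped Classical in`, exactly as here.) - /
theorem stub_isolatedShellDomination :
    ∀ (σ τ : ℝ) (N : ℕ), 0 < σ → 0 < τ → hsDiameter σ N < 8⁻¹ →
      ∀ (Φ : Flow σ N) (i : Fin (N + 1)) (z : Phase N), z ∈ Φ.good →
        ENNReal.ofReal (σ / τ * Φ.collisionSum (Set.Ioc 0 (window τ N)) (fun c =>
            if c.fst = i ∧ 2 * hsDiameter σ N ≤ ‖c.preVel.1 - c.preVel.2‖ * c.time ∧
                (∀ k : Fin (N + 1), k ≠ i → k ≠ c.snd →
                  ∀ t ∈ Set.Icc (c.time - 2 * hsDiameter σ N / ‖c.preVel.1 - c.preVel.2‖) c.time,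
                    3 * hsDiameter σ N < ‖(Torus.geometry (Fin 3)).sepVec (Φ.flow t z k).1 (Φ.flow t z i).1‖ ∧
                    3 * hsDiameter σ N < ‖(Torus.geometry (Fin 3)).sepVec (Φ.flow t z k).1 (Φ.flow t z c.snd).1‖)
            then impulse c else 0) z) ≤
          (ENNReal.ofReal (window τ N))⁻¹ * ∫⁻ t in Set.Ioc 0 (window τ N), ENNReal.ofReal
            (∑ j : Fin (N + 1), if j ≠ i ∧ hsDiameter σ N < ‖(Torus.geometry (Fin 3)).sepVec (Φ.flow t z i).1 (Φ.flow t z j).1‖ ∧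
                ‖(Torus.geometry (Fin 3)).sepVec (Φ.flow t z i).1 (Φ.flow t z j).1‖ < 2 * hsDiameter σ N
              then ‖(Φ.flow t z i).2 - (Φ.flow t z j).2‖ ^ 2 * (1 + ‖(Φ.flow t z i).2 + (Φ.flow t z j).2‖ / 2) else 0) 

/ - - **R8 · the activity is own-path-determined** (card `ActivityLocality`, pathwise congruence). For a good datum `z` of the torus system
whose range-`R` cluster around `i` is a good datum of the cluster flow, if the isolated cluster run reproduces `i`'s path on the closed
window `[0, w]` (`Φ_t z i = localClusterState Ψs R t z i`, the badness notion of stmt-13916 verbatim), then it reproduces `i`'s window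
transfer activity: both equal `(σ/τ) Σ_{jump times t ∈ (0,w] of v_i} (‖v_i(t) − v_i(t⁻)‖ + |‖v_i(t)‖² − ‖v_i(t⁻)‖²|/2)` (records with
`fst = i` ↔ contacts of `i` ↔ velocity jumps of `i` on a good orbit — non-grazing collision law, one partner per collision time; the
record's `preVel.1` is the left limit of `v_i`). - /
theorem stub_activityLocality :
    ∀ (σ τ R : ℝ) (N : ℕ), 0 < σ → 0 < τ → hsDiameter σ N < 2⁻¹ →
      ∀ (Φ : Flow σ N) (Ψs : (k : ℕ) → HardSphereFlow (Torus.geometry (Fin 3)) (hsDiameter σ N) k)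
        (i : Fin (N + 1)) (z : Phase N), z ∈ Φ.good →
        Config.restrictTo (rangeCluster (Torus.geometry (Fin 3)) R z i) z ∈
          (Ψs (rangeCluster (Torus.geometry (Fin 3)) R z i).card).good →
        (∀ t ∈ Set.Icc 0 (window τ N), Φ.flow t z i = localClusterState Ψs R t z i) →
        runAct σ τ Φ (window τ N) i z =
          σ / τ * (Ψs (rangeCluster (Torus.geometry (Fin 3)) R z i).card).collisionSum (Set.Ioc 0 (window τ N))
            (fun c => if c.fst = clusterIndex (rangeCluster (Torus.geometry (Fin 3)) R z i) i
                (self_mem_rangeCluster (Torus.geometry (Fin 3)) R z i)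
              then ‖c.postVel.1 - c.preVel.1‖ + |‖c.postVel.1‖ ^ 2 - ‖c.preVel.1‖ ^ 2| / 2 else 0)
            (Config.restrictTo (rangeCluster (Torus.geometry (Fin 3)) R z i) z) 

-/

/-! ## § 3 Composition: the four cores imply the crux, BY NAME on the route decl (`Iff.rfl` with C′; kernel-checked in CompositionC3) -/

/-- **The composition.** The four open pure-LD cores (with the landed S1/S2 of coarse-coin and the measurability theorems inside
`clampedTransferWindowLD_of_coreLD`) imply the crux `TwoClocks.ClampedTransferWindowLD`. -/
theorem ClampedTransferWindowLD_of :
    Summit.AtomisticToContinuum.HydrodynamicLimit.Theses.TwoClocks.ClampedTransferWindowLD :=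
  clampedTransferWindowLD_of_coreLD stub_overflowCountLD stub_coinBudgetLD stub_compensatorDefectCoreLD stub_rateWindowLD

end Summit.AtomisticToContinuum.HydrodynamicLimit.Theorems.ClampedTransferCoin.SketchLine

end
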